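/-
Copyright (c) 2026 the pub-hodgecm-mathlib formalisation cell (harness21).  Prover seat hodgecm-mathlib-K2E1-p10 (g5), Track B «K2-LIT», h413 = `stmt-HodgeConjecture-24833`,
R90-TF section S8 «ContSpec-n½», deal S8-R195 (i) §3b ∕ rulings S8-R199 (J-S8-ADM′: τ-admissible) and S8-R204 (J-S8-T1: ★ typ2's `R90S8ResGMidAtomTauU3Defs` = ESTATE T FILE 1
OF RECORD): ★ §3 `res_midBlock_le_residual_of_admissible` INSTANTIATED at the τ-admissible predicate, in ESTATE T's currency — rows over τ-admissible generators
(`IsTauLevel U₀`, level `tauLevel U₀ = ι_f(U₀)`, `ω = 1`, `IsArchFinite φ`) and the letter `hW1 : resGMidBlock ≤ resGMidBlockτ`.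
-/
import Summits.HodgeConjecture.HodgeConjecture.Theorems.R90S8ResGMidBlockLeResidualOfAdmissibleU3   -- ★ p864128 (this seat): §3 generic in `Adm` (+ ★ (R)′ OF RECORD p863946 and its engine)
import Summits.HodgeConjecture.HodgeConjecture.Theorems.R90S8ResGMidAtomTauU3Defs                 -- ★ ESTATE T FILE 1 (R90-CS-typ2): `IsTauLevel`, `tauLevel`, `IsArchFinite`, `resGMidAtomGenτ`, `resGMidBlockτ`, `resGMidBlockτ_le`
import HarnessLib

/-!
# S8 sub-socket (R)′ — `R90S8ResGMidBlockLeResidualOfTauAdmissibleU3`: THE MIDDLE BLOCK IS RESIDUAL, FROM ROWS AT τ-ADMISSIBLE GENERATORS + `hW1 : resGMidBlock ≤ resGMidBlockτ`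

Track B ∕ R90-TF, crux h413 = `stmt-HodgeConjecture-24833`, route `HCCMUnconditional`; cell `hodgecm-mathlib`, S8 «ContSpec-n½», sub-socket (R) `sock_S8_res_midBlock_le_residual` ((R)′, B ED. 7
:337); rulings S8-R197 ((O3)-as-letter), S8-R199 (τ-admissible), S8-R204 (ESTATE T FILE 1 OF RECORD).  THEOREMS ONLY (no `def`∕`instance`∕`notation`, no named-fact hypothesis, no `sorry`,
default heartbeats); lane `--supports … --as helper`; CLOSES NO SOCKET.  ★ §3 `res_midBlock_le_residual_of_admissible` (`R90S8ResGMidBlockLeResidualOfAdmissibleU3`) is (R)′ over rows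
at the generators of an ARBITRARY admissibility predicate `Adm K′ ω φ` plus `hW1`; THIS FILE is its τ-INSTANCE in the names every ESTATE T hand binds (★ typ2 `R90S8ResGMidAtomTauU3Defs`):
`Adm K′ ω φ := ∃ U₀, IsTauLevel U₀ ∧ K′ = tauLevel U₀ ∧ ω = 1 ∧ IsArchFinite φ`, i.e. the generator set ★ `resGMidAtomGenτ ξ μω U₀` over τ-levels, and the (O3) letter in T's currency
`hW1 : resGMidBlock ξ μω ≤ resGMidBlockτ ξ μω` (with ★ `resGMidBlockτ_le_resGMidBlock`: the two hulls coincide — «`K`-finite residues generate», [MW95 I.2.17, II.1, V.3.13]).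
* §1 HEAD **`res_midBlock_le_residual_of_tauAdmissible`** — binders: the socket frame `(L μ 𝔓 h𝔓 hne μω hμu hquad ξ)` of :337 verbatim (+ Borel structures); L1 `hDISC` verbatim; `hW1`;
  the rows `hCONT`, `hEXP`, the F5 block (once, verbatim), `hSCALrows`, `hSCATrows` of ★ (R)′ OF RECORD p863946, each quantified over τ-ADMISSIBLE generator data IN ★ `resGMidAtomGenτ`'s
  BINDER ORDER `∀ (U₀) (_ : IsTauLevel L U₀) (φ) (_ : φ ∈ chiSectionSpacePair χ₁ χ₂ (tauLevel L U₀) ⇑(1 : ↥(tauLevel L U₀) →* ℂ)) (_ : Continuous φ) (_ : IsArchFinite L φ) (Ec) (Sp) …` with the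
  bodies byte-identical.  Conclusion `resGMidBlock L μ ξ μω ≤ residualSubspace … μ 𝔓`.  PROOF: ★ §3 at the τ-predicate; its `hW1` from ours by ★ `resGMidBlockτ_le` + closure minimality +
  ★ `ClosedSubrep.subset_generate`; its rows from ours by `subst`.
HONEST LABEL: HC_CM is proved only modulo the 7 printed citations (2 remaining named inputs: hLiu418 = `stmt-HodgeConjecture-24832`, h413 = `stmt-HodgeConjecture-24833`) until
rung 0 closes; REL ≠ ★ ≠ BUILT; composition, not payment: conditional by construction on `hDISC`, `hW1` and the τ-admissible rows (the 1-dim-`K_∞`-type sub-case of `hCONT`∕`hEXP` is ★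
§2 + ★ §1b + the χ pole ledger; the rest is ESTATE T's `hEXPτ`); closes no socket; count-neutral.

## References
* [MoeglinWaldspurger1995] C. Mœglin, J.-L. Waldspurger, *Spectral Decomposition and Eisenstein Series* (1995), I.2.17, I.2.18, II.1, IV.1.11, IV.2.3, V.3.13.
* [Rogawski1990] J. D. Rogawski, *Automorphic Representations of Unitary Groups in Three Variables* (1990), §12.1 p. 171, §13.9 p. 229 (ii).
* [BorelJacquet1979] A. Borel, H. Jacquet, *Automorphic forms and automorphic representations*, Proc. Symp. Pure Math. 33.1 (1979), §1.3, §4.1–4.2.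
* [Langlands1976] R. P. Langlands, *On the Functional Equations Satisfied by Eisenstein Series*, LNM 544 (1976), §7.
-/

set_option autoImplicit false
set_option linter.dupNamespace false  -- the mandated namespace `…HodgeConjecture.HodgeConjecture.R90.S8` (LEAD #1 L1) repeats the summit's segment

noncomputable section

open MeasureTheory Measure NumberField IsDedekindDomain Set Filter Topology ContRepresentation
open scoped ENNReal NNReal ComplexConjugate InnerProductSpace Topology
open Literature.NumberTheory Literature.NumberTheory.Automorphic Literature.NumberTheory.Automorphic.UnitaryGroup Literature.NumberTheory.GaloisRepresentations AdelicGroupData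
open Literature.NumberTheory.Automorphic.Arthur2013.Leaves.TECR Literature.NumberTheory.Rogawski1990 Literature.NumberTheory.LFunctions
open Summit.HodgeConjecture.HodgeConjecture.Cruxes.H413.K2E1BorelEisensteinU Summit.HodgeConjecture.HodgeConjecture.Cruxes.H413.K2E1CharacterEisensteinU2Defs
open Summit.HodgeConjecture.HodgeConjecture.Cruxes.H413.K2E1CharacterEisensteinU3PairDefs Summit.HodgeConjecture.HodgeConjecture.Cruxes.H413.K2E1ChiSectionSpaceU3PairDefs Summit.HodgeConjecture.HodgeConjecture.Cruxes.H413.K2E1BLBorelSpacesU2Defs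
open Summit.HodgeConjecture.HodgeConjecture.Cruxes.H413.K2E1CuspidalSpectrumUnitary (residualSubspace mem_residualPart_iff)
open Summit.HodgeConjecture.HodgeConjecture.Cruxes.H413.K2E1ChiConstantTermFactorisationContinuedU3 (eventually_factorisation_of_unfolded)
open Summit.HodgeConjecture.HodgeConjecture.Cruxes.H413.K2E1ChiConstantTermHolomorphicCMThree (differentiableOn_middleCoefficient_slitPlane_cm_three)
open Summit.HodgeConjecture.HodgeConjecture.Cruxes.H413.K2E1ChiScatteringMiddlePoleU3 (exists_residue_at_threeHalves_cm_three)
open Summit.HodgeConjecture.HodgeConjecture.Cruxes.H413.K2E1SphericalEisensteinResidueConstantCMThreeOfLetters (exists_analyticAt_eventuallyEq_mul_sub_of_tendsto)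
open Summit.HodgeConjecture.HodgeConjecture.Cruxes.H413.R90S8ResGMidBlockScatteringOfRecordU3 (exists_hSCAT_of_factorisation integrable_restrict_mul_conj_of_bounded)

namespace Summit.HodgeConjecture.HodgeConjecture.R90.S8

variable (L : Type) [Field L] [NumberField L] [IsCMField L] [MeasurableSpace (quasiSplit (↥(maximalRealSubfield L)) L (IsCMField.complexConj L) 3).Adelic] [BorelSpace (quasiSplit (↥(maximalRealSubfield L)) L (IsCMField.complexConj L) 3).Adelic]

/-! ## §1 HEAD: (R)′ over rows at τ-ADMISSIBLE generators, plus `hW1 : resGMidBlock ≤ resGMidBlockτ` -/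

/-- **(R)′ FROM ROWS AT τ-ADMISSIBLE GENERATORS ONLY — `resGMidBlock ξ μω ≤ L²_res(𝔓)` AT THE SOCKET FRAME OF B ED. 7 :337, IN ESTATE T's CURRENCY.**  Binders: the socket frame
verbatim; L1 `hDISC`; `hW1 : resGMidBlock ξ μω ≤ resGMidBlockτ ξ μω` (★ typ2 T4); the rows `hCONT`, `hEXP`, F5 block (once), `hSCALrows`, `hSCATrows` of ★ (R)′ OF RECORD, each over
τ-admissible generator data `(U₀, IsTauLevel U₀, φ ∈ V(χ₁, χ₂; tauLevel U₀, 1)` continuous, `IsArchFinite φ`, `Ec, Sp, Fp, f)` in ★ `resGMidAtomGenτ`'s binder order.  PROOF: ★ §3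
`res_midBlock_le_residual_of_admissible` at `Adm K′ ω φ := ∃ U₀, IsTauLevel U₀ ∧ K′ = tauLevel U₀ ∧ ω = 1 ∧ IsArchFinite φ`.
[cite: MoeglinWaldspurger1995, I.2.17, I.2.18, IV.1.11, V.3.13] [cite: Rogawski1990, §13.9 p. 229 (ii)] [cite: BorelJacquet1979, §4.1] -/
theorem res_midBlock_le_residual_of_tauAdmissible [MeasurableSpace (AdeleRing (𝓞 L) L)ˣ] [BorelSpace (AdeleRing (𝓞 L) L)ˣ]
    (μ : Measure (quasiSplit (↥(maximalRealSubfield L)) L (IsCMField.complexConj L) 3).automorphicQuotient) [(quasiSplit (↥(maximalRealSubfield L)) L (IsCMField.complexConj L) 3).IsAutomorphicMeasure μ]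
    (𝔓 : (quasiSplit (↥(maximalRealSubfield L)) L (IsCMField.complexConj L) 3).ParabolicUnipotentData) (h𝔓 : ∀ j : 𝔓.ι, 𝔓.radical j = adelicUnipotent (↥(maximalRealSubfield L)) L (IsCMField.complexConj L) 3) (hne : Nonempty 𝔓.ι)
    (μω : HeckeCharacter L) (hμu : μω.IsUnitary) (hquad : (∀ x : Literature.NumberTheory.GaloisRepresentations.ideleGroup ↥(maximalRealSubfield L), μω (AdeleRing.ideleBaseChange (↥(maximalRealSubfield L)) L x) = quadraticHeckeCharCM L x)) (ξ : OneDimAutRepH L)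
    -- L1 at the frame
    (hDISC : ∀ (E : Submodule ℂ (resGMidBlock L μ ξ μω).toSubmodule)
          (hE : ∀ k, ∀ x ∈ E, ((resGMidBlock L μ ξ μω).toContRep.restrict (((standardMaximalCompactGL 3 L).comap (adelicVal (↥(maximalRealSubfield L)) L (IsCMField.complexConj L) 3 ((StdForm.antidiagonal 3).over L)) : Subgroup (quasiSplit (↥(maximalRealSubfield L)) L (IsCMField.complexConj L) 3).Adelic)).subtype) k x ∈ E), FiniteDimensional ℂ E →
          (((resGMidBlock L μ ξ μω).toContRep.restrict (((standardMaximalCompactGL 3 L).comap (adelicVal (↥(maximalRealSubfield L)) L (IsCMField.complexConj L) 3 ((StdForm.antidiagonal 3).over L)) : Subgroup (quasiSplit (↥(maximalRealSubfield L)) L (IsCMField.complexConj L) 3).Adelic)).subtype).subRep E hE).IsIrreducible →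
          FiniteDimensional ℂ (Representation.homRangeSum ((resGMidBlock L μ ξ μω).toContRep.restrict (((standardMaximalCompactGL 3 L).comap (adelicVal (↥(maximalRealSubfield L)) L (IsCMField.complexConj L) 3 ((StdForm.antidiagonal 3).over L)) : Subgroup (quasiSplit (↥(maximalRealSubfield L)) L (IsCMField.complexConj L) 3).Adelic)).subtype).toRepresentation (((resGMidBlock L μ ξ μω).toContRep.restrict (((standardMaximalCompactGL 3 L).comap (adelicVal (↥(maximalRealSubfield L)) L (IsCMField.complexConj L) 3 ((StdForm.antidiagonal 3).over L)) : Subgroup (quasiSplit (↥(maximalRealSubfield L)) L (IsCMField.complexConj L) 3).Adelic)).subtype).subRep E hE)))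
    -- (W1) IN ESTATE T's CURRENCY (★ typ2 `R90S8ResGMidAtomTauU3Defs`): the middle block lies in (hence EQUALS, ★ `resGMidBlockτ_le_resGMidBlock`) the τ-ADMISSIBLE middle block
    (hW1 : resGMidBlock L μ ξ μω ≤ resGMidBlockτ L μ ξ μω)
    -- hCONT at the frame: per τ-ADMISSIBLE generator, every normalised Heisenberg package
    (hCONT : ∀ (U₀ : Subgroup ↥(finAdelic (↥(maximalRealSubfield L)) L (IsCMField.complexConj L) 3 ((StdForm.antidiagonal 3).over L))) (_ : IsTauLevel L U₀)
      (φ : (quasiSplit (↥(maximalRealSubfield L)) L (IsCMField.complexConj L) 3).Adelic → ℂ) (_ : φ ∈ chiSectionSpacePair (ξ.bcη⁻¹ * ξ.bcψ⁻¹ * μω) ξ.ψ (tauLevel L U₀) ((1 : ↥(tauLevel L U₀) →* ℂ) : ↥(tauLevel L U₀) → ℂ)) (_ : Continuous φ)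
      (_ : IsArchFinite L φ)
      (Ec : ℂ → (quasiSplit (↥(maximalRealSubfield L)) L (IsCMField.complexConj L) 3).Adelic → ℂ) (Sp : Finset ℂ) (_ : ∀ s ∈ Sp, s.im = 0 ∧ 1 < s.re ∧ s.re ≤ 2)
      (_ : ∀ g, DifferentiableOn ℂ (fun z => Ec z g) ({z : ℂ | 1 < z.re} \ (↑Sp : Set ℂ)))
      (_ : ∀ z : ℂ, 2 < z.re → Ec z = eisensteinSeriesU (flatSectionU φ z))
      (Fp : (quasiSplit (↥(maximalRealSubfield L)) L (IsCMField.complexConj L) 3).Adelic → ℂ → ℂ) (_ : ∀ g, AnalyticAt ℂ (Fp g) ((3 : ℂ) / 2))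
      (_ : ∀ g, Fp g =ᶠ[𝓝[≠] ((3 : ℂ) / 2)] fun z => (z - (3 : ℂ) / 2) * Ec z g)
      (f : (quasiSplit (↥(maximalRealSubfield L)) L (IsCMField.complexConj L) 3).L2 μ) (_ : (f : (quasiSplit (↥(maximalRealSubfield L)) L (IsCMField.complexConj L) 3).automorphicQuotient → ℂ) =ᵐ[μ] fun x => Fp (Quotient.out (x : (quasiSplit (↥(maximalRealSubfield L)) L (IsCMField.complexConj L) 3).Adelic ⧸ (quasiSplit (↥(maximalRealSubfield L)) L (IsCMField.complexConj L) 3).quotientSubgroup))⁻¹ ((3 : ℂ) / 2))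
      (ν : Measure ↥(adelicUnipotent (↥(maximalRealSubfield L)) L (IsCMField.complexConj L) 3)) (_ : ν.IsHaarMeasure) (𝓕 : Set ↥(adelicUnipotent (↥(maximalRealSubfield L)) L (IsCMField.complexConj L) 3)) (_ : IsFundamentalDomain ↥(rationalUnipotent (↥(maximalRealSubfield L)) L (IsCMField.complexConj L) 3) 𝓕 ν) (_ : IsCompact (closure 𝓕)) (_ : ν.IsInvInvariant) (_ : ν 𝓕 = 1),
      ∃ (T : ℝ≥0) (_ : 1 ≤ T) (S : Finset ℂ) (_ : ∀ s ∈ S, s.im = 0) (Fam : ℂ → (quasiSplit (↥(maximalRealSubfield L)) L (IsCMField.complexConj L) 3).L2 μ),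
        DifferentiableOn ℂ Fam ({z : ℂ | 1 < z.re} \ (↑(Sp ∪ S) : Set ℂ)) ∧
        ∀ z ∈ ({z : ℂ | 1 < z.re} \ (↑(Sp ∪ S) : Set ℂ)), ((Fam z : (quasiSplit (↥(maximalRealSubfield L)) L (IsCMField.complexConj L) 3).L2 μ) : (quasiSplit (↥(maximalRealSubfield L)) L (IsCMField.complexConj L) 3).automorphicQuotient → ℂ) =ᵐ[μ] (quasiSplit (↥(maximalRealSubfield L)) L (IsCMField.complexConj L) 3).quotFun (truncation ν 𝓕 T (Ec z)))
    -- (V) (i): the exports' LAYER-2 rows, per τ-ADMISSIBLE generator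
    (hEXP : ∀ (U₀ : Subgroup ↥(finAdelic (↥(maximalRealSubfield L)) L (IsCMField.complexConj L) 3 ((StdForm.antidiagonal 3).over L))) (_ : IsTauLevel L U₀)
      (φ : (quasiSplit (↥(maximalRealSubfield L)) L (IsCMField.complexConj L) 3).Adelic → ℂ) (_ : φ ∈ chiSectionSpacePair (ξ.bcη⁻¹ * ξ.bcψ⁻¹ * μω) ξ.ψ (tauLevel L U₀) ((1 : ↥(tauLevel L U₀) →* ℂ) : ↥(tauLevel L U₀) → ℂ)) (_ : Continuous φ)
      (_ : IsArchFinite L φ)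
      (Ec : ℂ → (quasiSplit (↥(maximalRealSubfield L)) L (IsCMField.complexConj L) 3).Adelic → ℂ) (Sp : Finset ℂ) (_ : ∀ s ∈ Sp, s.im = 0 ∧ 1 < s.re ∧ s.re ≤ 2)
      (_ : ∀ g, DifferentiableOn ℂ (fun z => Ec z g) ({z : ℂ | 1 < z.re} \ (↑Sp : Set ℂ)))
      (_ : ∀ z : ℂ, 2 < z.re → Ec z = eisensteinSeriesU (flatSectionU φ z))
      (Fp : (quasiSplit (↥(maximalRealSubfield L)) L (IsCMField.complexConj L) 3).Adelic → ℂ → ℂ) (_ : ∀ g, AnalyticAt ℂ (Fp g) ((3 : ℂ) / 2))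
      (_ : ∀ g, Fp g =ᶠ[𝓝[≠] ((3 : ℂ) / 2)] fun z => (z - (3 : ℂ) / 2) * Ec z g)
      (f : (quasiSplit (↥(maximalRealSubfield L)) L (IsCMField.complexConj L) 3).L2 μ) (_ : (f : (quasiSplit (↥(maximalRealSubfield L)) L (IsCMField.complexConj L) 3).automorphicQuotient → ℂ) =ᵐ[μ] fun x => Fp (Quotient.out (x : (quasiSplit (↥(maximalRealSubfield L)) L (IsCMField.complexConj L) 3).Adelic ⧸ (quasiSplit (↥(maximalRealSubfield L)) L (IsCMField.complexConj L) 3).quotientSubgroup))⁻¹ ((3 : ℂ) / 2)), (∀ z ∈ ({z : ℂ | 1 < z.re} \ (↑Sp : Set ℂ)), Continuous (Ec z)) ∧ (∀ z₁ ∈ ({z : ℂ | 1 < z.re} \ (↑Sp : Set ℂ)), ∀ K : Set (quasiSplit (↥(maximalRealSubfield L)) L (IsCMField.complexConj L) 3).Adelic, IsCompact K → ∃ V ∈ 𝓝 z₁, ∃ M : ℝ, ∀ z ∈ V, ∀ g ∈ K, ‖Ec z g‖ ≤ M))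
    -- (V) (iii): the F5 scalar rows at `φ := ξ.bcη⁻¹ * μω`, `η := 1`, ONCE
    {S : Set (HeightOneSpectrum (𝓞 L))} {T' : Set (HeightOneSpectrum (𝓞 ↥(maximalRealSubfield L)))}
    (hS : S.Finite) (hurφ : ∀ w ∉ S, (ξ.bcη⁻¹ * μω).IsUnramifiedAt w) (hT' : T'.Finite) (hurη : ∀ v ∉ T', (1 : HeckeCharacter ↥(maximalRealSubfield L)).IsUnramifiedAt v)
    (q qc : ℂ → ℂ) {P : Set ℂ} (hqcq : ∀ z : ℂ, 2 < z.re → qc z = q z) (hPcd : ∀ z₀ : ℂ, ∀ᶠ s in 𝓝[≠] z₀, s ∉ P) (hqa : ∀ z : ℂ, z ∉ P → AnalyticAt ℂ qc z)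
    (A : ℂ → ℂ) (hA : DifferentiableOn ℂ A {z : ℂ | 1 < z.re})
    (hsrc : ∀ z : ℂ, 2 < z.re → q z = A z *
          ((partialStandardL S (fun w => {(ξ.bcη⁻¹ * μω).valueAtUniformizer w}) (z - 1) * partialStandardL T' (fun v => {(1 : HeckeCharacter ↥(maximalRealSubfield L)).valueAtUniformizer v}) (2 * z - 2)) /
            (partialStandardL S (fun w => {(ξ.bcη⁻¹ * μω).valueAtUniformizer w}) z * partialStandardL T' (fun v => {(1 : HeckeCharacter ↥(maximalRealSubfield L)).valueAtUniformizer v}) (2 * z - 1))))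
    (hA32 : A (3 / 2) ≠ 0) (cS : ℂ → ℂ) (hq : ∀ z : ℂ, 2 < z.re → q z = A z * cS z)
    -- J-S8-SCAL: the unfolding + profile rows, per τ-ADMISSIBLE generator
    (hSCALrows : ∀ (U₀ : Subgroup ↥(finAdelic (↥(maximalRealSubfield L)) L (IsCMField.complexConj L) 3 ((StdForm.antidiagonal 3).over L))) (_ : IsTauLevel L U₀)
      (φ : (quasiSplit (↥(maximalRealSubfield L)) L (IsCMField.complexConj L) 3).Adelic → ℂ) (_ : φ ∈ chiSectionSpacePair (ξ.bcη⁻¹ * ξ.bcψ⁻¹ * μω) ξ.ψ (tauLevel L U₀) ((1 : ↥(tauLevel L U₀) →* ℂ) : ↥(tauLevel L U₀) → ℂ)) (_ : Continuous φ)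
      (_ : IsArchFinite L φ)
      (Ec : ℂ → (quasiSplit (↥(maximalRealSubfield L)) L (IsCMField.complexConj L) 3).Adelic → ℂ) (Sp : Finset ℂ) (_ : ∀ s ∈ Sp, s.im = 0 ∧ 1 < s.re ∧ s.re ≤ 2)
      (_ : ∀ g, DifferentiableOn ℂ (fun z => Ec z g) ({z : ℂ | 1 < z.re} \ (↑Sp : Set ℂ)))
      (_ : ∀ z : ℂ, 2 < z.re → Ec z = eisensteinSeriesU (flatSectionU φ z))
      (Fp : (quasiSplit (↥(maximalRealSubfield L)) L (IsCMField.complexConj L) 3).Adelic → ℂ → ℂ) (_ : ∀ g, AnalyticAt ℂ (Fp g) ((3 : ℂ) / 2))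
      (_ : ∀ g, Fp g =ᶠ[𝓝[≠] ((3 : ℂ) / 2)] fun z => (z - (3 : ℂ) / 2) * Ec z g)
      (f : (quasiSplit (↥(maximalRealSubfield L)) L (IsCMField.complexConj L) 3).L2 μ) (_ : (f : (quasiSplit (↥(maximalRealSubfield L)) L (IsCMField.complexConj L) 3).automorphicQuotient → ℂ) =ᵐ[μ] fun x => Fp (Quotient.out (x : (quasiSplit (↥(maximalRealSubfield L)) L (IsCMField.complexConj L) 3).Adelic ⧸ (quasiSplit (↥(maximalRealSubfield L)) L (IsCMField.complexConj L) 3).quotientSubgroup))⁻¹ ((3 : ℂ) / 2))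
      (ν : Measure ↥(adelicUnipotent (↥(maximalRealSubfield L)) L (IsCMField.complexConj L) 3)) (_ : ν.IsHaarMeasure) (𝓕 : Set ↥(adelicUnipotent (↥(maximalRealSubfield L)) L (IsCMField.complexConj L) 3)) (_ : IsFundamentalDomain ↥(rationalUnipotent (↥(maximalRealSubfield L)) L (IsCMField.complexConj L) 3) 𝓕 ν) (_ : IsCompact (closure 𝓕)) (_ : ν.IsInvInvariant) (_ : ν 𝓕 = 1),
      ∃ (Ag : (quasiSplit (↥(maximalRealSubfield L)) L (IsCMField.complexConj L) 3).Adelic → ℂ → ℂ) (M : ℝ),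
        (∀ g, DifferentiableOn ℂ (Ag g) {z : ℂ | 1 < z.re}) ∧ (∀ g, ‖Ag g (3 / 2)‖ ≤ M) ∧
        (∀ z : ℂ, 2 < z.re → ∀ g : (quasiSplit (↥(maximalRealSubfield L)) L (IsCMField.complexConj L) 3).Adelic, (borelConstantTerm ν 𝓕 (Ec z) g - φ g * (((borelHeight g : ℝ≥0) : ℝ) : ℂ) ^ z) / (((borelHeight g : ℝ≥0) : ℝ) : ℂ) ^ (2 - z) = Ag g z * cS z) ∧
        (Measurable fun g : (quasiSplit (↥(maximalRealSubfield L)) L (IsCMField.complexConj L) 3).Adelic => Ag g ((3 : ℂ) / 2)) ∧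
        (∀ b ∈ arithmeticBorel (↥(maximalRealSubfield L)) L (IsCMField.complexConj L) 3, ∀ x : (quasiSplit (↥(maximalRealSubfield L)) L (IsCMField.complexConj L) 3).Adelic, Ag ((b : (quasiSplit (↥(maximalRealSubfield L)) L (IsCMField.complexConj L) 3).Adelic) * x) ((3 : ℂ) / 2) = Ag x ((3 : ℂ) / 2)) ∧
        (∀ (u : ↥(adelicUnipotent (↥(maximalRealSubfield L)) L (IsCMField.complexConj L) 3)) (g : (quasiSplit (↥(maximalRealSubfield L)) L (IsCMField.complexConj L) 3).Adelic), Ag ((u : (quasiSplit (↥(maximalRealSubfield L)) L (IsCMField.complexConj L) 3).Adelic) * g) ((3 : ℂ) / 2) = Ag g ((3 : ℂ) / 2)))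
    -- hSCAT's rows, per τ-ADMISSIBLE generator
    (hSCATrows : ∀ (U₀ : Subgroup ↥(finAdelic (↥(maximalRealSubfield L)) L (IsCMField.complexConj L) 3 ((StdForm.antidiagonal 3).over L))) (_ : IsTauLevel L U₀)
      (φ : (quasiSplit (↥(maximalRealSubfield L)) L (IsCMField.complexConj L) 3).Adelic → ℂ) (_ : φ ∈ chiSectionSpacePair (ξ.bcη⁻¹ * ξ.bcψ⁻¹ * μω) ξ.ψ (tauLevel L U₀) ((1 : ↥(tauLevel L U₀) →* ℂ) : ↥(tauLevel L U₀) → ℂ)) (_ : Continuous φ)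
      (_ : IsArchFinite L φ)
      (Ec : ℂ → (quasiSplit (↥(maximalRealSubfield L)) L (IsCMField.complexConj L) 3).Adelic → ℂ) (Sp : Finset ℂ) (_ : ∀ s ∈ Sp, s.im = 0 ∧ 1 < s.re ∧ s.re ≤ 2)
      (_ : ∀ g, DifferentiableOn ℂ (fun z => Ec z g) ({z : ℂ | 1 < z.re} \ (↑Sp : Set ℂ)))
      (_ : ∀ z : ℂ, 2 < z.re → Ec z = eisensteinSeriesU (flatSectionU φ z))
      (Fp : (quasiSplit (↥(maximalRealSubfield L)) L (IsCMField.complexConj L) 3).Adelic → ℂ → ℂ) (_ : ∀ g, AnalyticAt ℂ (Fp g) ((3 : ℂ) / 2))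
      (_ : ∀ g, Fp g =ᶠ[𝓝[≠] ((3 : ℂ) / 2)] fun z => (z - (3 : ℂ) / 2) * Ec z g)
      (f : (quasiSplit (↥(maximalRealSubfield L)) L (IsCMField.complexConj L) 3).L2 μ) (_ : (f : (quasiSplit (↥(maximalRealSubfield L)) L (IsCMField.complexConj L) 3).automorphicQuotient → ℂ) =ᵐ[μ] fun x => Fp (Quotient.out (x : (quasiSplit (↥(maximalRealSubfield L)) L (IsCMField.complexConj L) 3).Adelic ⧸ (quasiSplit (↥(maximalRealSubfield L)) L (IsCMField.complexConj L) 3).quotientSubgroup))⁻¹ ((3 : ℂ) / 2))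
      (ν : Measure ↥(adelicUnipotent (↥(maximalRealSubfield L)) L (IsCMField.complexConj L) 3)) (_ : ν.IsHaarMeasure) (𝓕 : Set ↥(adelicUnipotent (↥(maximalRealSubfield L)) L (IsCMField.complexConj L) 3)) (_ : IsFundamentalDomain ↥(rationalUnipotent (↥(maximalRealSubfield L)) L (IsCMField.complexConj L) 3) 𝓕 ν) (_ : IsCompact (closure 𝓕)) (_ : ν.IsInvInvariant) (_ : ν 𝓕 = 1),
      ∃ (ι : Type) (_ : Fintype ι) (φ' : ι → (quasiSplit (↥(maximalRealSubfield L)) L (IsCMField.complexConj L) 3).Adelic → ℂ) (qv qcv : ι → ℂ → ℂ) (P' : Set ℂ) (r : ι → ℂ → ℂ),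
        (∀ j, Continuous (φ' j)) ∧ (∀ j, ∃ C : ℝ, ∀ x, ‖φ' j x‖ ≤ C) ∧
        (∀ z : ℂ, 2 < z.re → (∑ j, qv j z • φ' j) = ((((ν 𝓕).toReal⁻¹ : ℝ)) : ℂ) • (fun g : (quasiSplit (↥(maximalRealSubfield L)) L (IsCMField.complexConj L) 3).Adelic => (∫ v : ↥(adelicUnipotent (↥(maximalRealSubfield L)) L (IsCMField.complexConj L) 3), flatSectionU φ z ((quasiSplit (↥(maximalRealSubfield L)) L (IsCMField.complexConj L) 3).toAdelic (weylLongU ((IsCMField.complexConj L : L ≃ₐ[↥(maximalRealSubfield L)] L) : L →+* L) (rfl : (StdForm.antidiagonal 3).over L = (StdForm.antidiagonal 3).over L)) * ((v : (quasiSplit (↥(maximalRealSubfield L)) L (IsCMField.complexConj L) 3).Adelic) * g)) ∂ν) * (((borelHeight g : ℝ) : ℂ) ^ (z - 2)))) ∧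
        (∀ j, DifferentiableOn ℂ (qcv j) P'ᶜ) ∧ (∀ j (z : ℂ), 2 < z.re → qcv j z = qv j z) ∧ (∀ z ∈ P', z.im = 0) ∧
        (∀ j, AnalyticAt ℂ (r j) (3 / 2 : ℂ)) ∧ (∀ j, ∀ᶠ z in 𝓝[≠] ((3 / 2 : ℂ)), qcv j z = qc z * r j z) ∧
        (∀ (μK : Measure ↥((standardMaximalCompactGL 3 L).comap (adelicVal (↥(maximalRealSubfield L)) L (IsCMField.complexConj L) 3 ((StdForm.antidiagonal 3).over L)) : Subgroup (quasiSplit (↥(maximalRealSubfield L)) L (IsCMField.complexConj L) 3).Adelic)) (_ : μK.IsHaarMeasure) (νI : Measure (AdeleRing (𝓞 L) L)ˣ) (_ : νI.IsHaarMeasure) (𝓕I : Set (AdeleRing (𝓞 L) L)ˣ) (_ : IsIdeleClassDomain L 𝓕I) (wc : ℂ → ℂ),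
          (∀ z : ℂ, wc z = (∑ j, qcv j z * ∫ k, φ' j (k : (quasiSplit (↥(maximalRealSubfield L)) L (IsCMField.complexConj L) 3).Adelic) * conj (φ (k : (quasiSplit (↥(maximalRealSubfield L)) L (IsCMField.complexConj L) 3).Adelic)) ∂μK) * ∫ x in {x : (AdeleRing (𝓞 L) L)ˣ | (IdeleClassGroup.ideleNorm L x : ℝ) ≤ 1} ∩ 𝓕I, ((IdeleClassGroup.ideleNorm L x : ℝ) : ℂ) * (((reflectChar (IsCMField.complexConj L) (ξ.bcη⁻¹ * ξ.bcψ⁻¹ * μω) x : ℂˣ) : ℂ) * conj (((ξ.bcη⁻¹ * ξ.bcψ⁻¹ * μω) x : ℂˣ) : ℂ)) ∂νI) → ∀ᶠ x : ℝ in 𝓝[≠] (3 / 2 : ℝ), (wc (x : ℂ)).im = 0)) :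
    resGMidBlock L μ ξ μω ≤ residualSubspace (quasiSplit (↥(maximalRealSubfield L)) L (IsCMField.complexConj L) 3) μ 𝔓 := by
  refine res_midBlock_le_residual_of_admissible L μ 𝔓 h𝔓 hne μω hμu hquad ξ (fun K' ω φ => ∃ U₀, IsTauLevel L U₀ ∧ K' = tauLevel L U₀ ∧ ω = 1 ∧ IsArchFinite L φ) hDISC
    ?_ ?_ ?_ hS hurφ hT' hurη q qc hqcq hPcd hqa A hA hsrc hA32 cS hq ?_ ?_
  · -- hW1: every τ-atom lies in the closed hull of the `Adm`-admissible generators (closure minimality; ★ `resGMidBlockτ_le`, ★ `ClosedSubrep.subset_generate`)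
    refine hW1.trans (resGMidBlockτ_le L μ ξ μω _ fun U₀ hU₀ => Submodule.topologicalClosure_minimal _ (Submodule.span_le.2 fun f hf => ?_) (ClosedSubrep.isClosed _))
    obtain ⟨φ, hφ, hc, hfin, Ec, Sp, hSp, hEc, hEis, Fp, hFp, hres, hae⟩ := hf
    exact ClosedSubrep.subset_generate _ ⟨tauLevel L U₀, 1, φ, ⟨U₀, hU₀, rfl, rfl, hfin⟩, hφ, hc, Ec, Sp, hSp, hEc, hEis, Fp, hFp, hres, hae⟩
  · intro K' ω φ hAdm hφV hφc Ec Sp hSp hhol hEis Fp hFp hFpE f hf ν hν 𝓕 h𝓕N h𝓕c hνi hν1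
    obtain ⟨U₀, hU₀, rfl, rfl, hfin⟩ := hAdm
    exact hCONT U₀ hU₀ φ hφV hφc hfin Ec Sp hSp hhol hEis Fp hFp hFpE f hf ν hν 𝓕 h𝓕N h𝓕c hνi hν1
  · intro K' ω φ hAdm hφV hφc Ec Sp hSp hhol hEis Fp hFp hFpE f hf
    obtain ⟨U₀, hU₀, rfl, rfl, hfin⟩ := hAdm
    exact hEXP U₀ hU₀ φ hφV hφc hfin Ec Sp hSp hhol hEis Fp hFp hFpE f hf
  · intro K' ω φ hAdm hφV hφc Ec Sp hSp hhol hEis Fp hFp hFpE f hf ν hν 𝓕 h𝓕N h𝓕c hνi hν1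
    obtain ⟨U₀, hU₀, rfl, rfl, hfin⟩ := hAdm
    exact hSCALrows U₀ hU₀ φ hφV hφc hfin Ec Sp hSp hhol hEis Fp hFp hFpE f hf ν hν 𝓕 h𝓕N h𝓕c hνi hν1
  · intro K' ω φ hAdm hφV hφc Ec Sp hSp hhol hEis Fp hFp hFpE f hf ν hν 𝓕 h𝓕N h𝓕c hνi hν1
    obtain ⟨U₀, hU₀, rfl, rfl, hfin⟩ := hAdm
    exact hSCATrows U₀ hU₀ φ hφV hφc hfin Ec Sp hSp hhol hEis Fp hFp hFpE f hf ν hν 𝓕 h𝓕N h𝓕c hνi hν1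

end Summit.HodgeConjecture.HodgeConjecture.R90.S8

end
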